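import Summits.RiemannHypothesis.RiemannHypothesis.Theorems.SemilocalNegCert
import HarnessLib

/-!
# Semi-local threshold, negative side — NEW RUNG `a*({2}) ≤ 0.5575 = 223/400` by the `WeilNegCert2` format

Cell `rh-explicit` (HOME `run/shared/lean/pub/rh-explicit/`), seat cc-s2-4 (`HOME/cc-s2-4/CC4-LEAN.md` §6).
Honest framing: a NEGATIVE statement about the tree's `{∞,2}` semi-local Weil form (consolation-prize side of the
motivic door); nothing here bears on RH.  Previous tree bound: `a*({2}) ≤ 57/100`
(`MotivicDoorSemilocalUndecicBound.lean`).

Witness: the odd polynomial of degree `23` below (bottom eigenvector of the certificate functional on `12` odd Legendre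
modes `P_{2j+1}(x/b)`, rounded to rationals; seat file `work/py/search.py`), `b = 0.5575 = 223/400`; orders
`(nA, mA, KA, Kt, nt, ne) = (14, 7, 5, 10, 40, 16)`; sharp constant `c2SharpQ`.  Exact-rational margin of the checked
inequality: `2.0·10⁻⁷·‖G‖²`.  Everything is verified by the kernel (`decide`), nothing is trusted.
-/

set_option linter.dupNamespace false

namespace Summit.RiemannHypothesis.RiemannHypothesis.Theorems.SemilocalPolyWitness

/-- The odd witness polynomial for `b = 0.5575 = 223/400` (degree `23`, coefficients in powers of `x`). -/
def p05575 : List ℚ :=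
  [0, 16868764019632851/2922905600000000, 0, -7136659571277609/181691465728000, 0,
    -81581199183257571/282354215599616, 0, 494782363965324703125/54848409326380094, 0,
    -182750457043889806500000000/1363778273695777847263, 0,
    420388751269787664000000000000/304122555034158459939649, 0,
    -33183501416259509952000000000000000000/3372587450262487530117553541983, 0,
    7970189730922728622080000000000000000000000/167715401314103242385215820089272607, 0,
    -1269778978004009648947200000000000000000000000000/8340319191949040140574397517219437473503, 0,
    128101952655009319354368000000000000000000000000000000/414755733096433817150624214133805406119830687, 0,
    -7390960348319424958169088000000000000000000000000000000000/20625387851152557293083391544660009040933060233823,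
    0,
    185344049482829724332851200000000000000000000000000000000000000/1025679912449965521627743978124397589596560152367783967]

/-- The certificate at `b = 0.5575 = 223/400`. -/
def cert05575 : WeilNegCert2 := ⟨p05575, 223 / 400, 14, 7, 5, 10, 40, 16⟩

set_option maxHeartbeats 0 in
/-- The checker accepts `cert05575` against the sharp constant. -/
theorem check_cert05575 : cert05575.check c2SharpQ = true := by
  decide +kernel

/-- **NEW RUNG: `a*({2}) ≤ 0.5575 = 223/400`.** -/
theorem weilSemilocalThreshold_two_le_05575 :
    MotivicDoor.SemilocalThreshold.weilSemilocalThreshold {2} ≤ ((223 / 400 : ℚ) : ℝ) :=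
  weilSemilocalThreshold_two_le_of_check_sharp cert05575 check_cert05575

/-- Failure form: the `{∞,2}` form takes a negative value on every window `a > 0.5575 = 223/400`. -/
theorem not_weilSemilocalPositivityOn_two_of_gt_05575 {a : ℝ} (ha : ((223 / 400 : ℚ) : ℝ) < a) :
    ¬ Literature.NumberTheory.LFunctions.WeilSemilocalPositivityOn {2} a :=
  MotivicDoor.SemilocalThreshold.not_weilSemilocalPositivityOn_iff_weilSemilocalThreshold_lt.2
    (weilSemilocalThreshold_two_le_05575.trans_lt ha)

end Summit.RiemannHypothesis.RiemannHypothesis.Theorems.SemilocalPolyWitness
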